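/-
Copyright: cell pub-balaban-gaps, seat ne8 (estimate NE7c), gen 17. Project licence.
-/
import Literature.MathematicalPhysics.QuantumFieldTheory.Balaban1983to89.T4ShellMeasure

/-!
# Road (δ)'s cascade constant is SHARP: `T4ShellMeasure` §8's cascade count `∏_σ (ν_σ + 1) − 1` (two-sided `2(∏_σ (ν_σ + 1) − 1)`) is
# ATTAINED WITH EQUALITY, for every number of live stages `S` and every test profile `ν`, by the mixed-radix decision tree — so the
# PRODUCT (not §7's sum) is the exact price of ADAPTIVITY on the (R)+(W1) abstraction (row NE7c; junction J-22; MODEL, [folklore])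

Cell `pub-balaban-gaps` (G2), seat ne8, estimate **NE7c** (`T4IndicatorShell.ShellWeightBound`; two-run artefact, NOT PRINTED in [Bałaban 1983–89], NOT
PROVED).  Proof-only file under `Spine/NE7c/`: imports the tree's `Balaban1983to89.T4ShellMeasure` only (`LiveStage`, `LiveStage.path`, `LiveStage.hits`,
`LiveStage.hitsAbove`, `livePaths`, and the bounds `sum_hits_livePaths_le`, `sum_hits₂_livePaths_le` consumed BY NAME); companion of this seat's files
37 `LiveFactorOneStageModel` (J-20) and 38 `LiveFactorProductStageModel` (J-21).  Mathlib finite sums otherwise.  Nothing of Bałaban's is named; no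
`def`; 0 `sorry`.

THE QUESTION (HANDOFF § GEN 16 optional point (vii′); `T4ShellMeasure` §8 «Its price is the constant `V` (a product over the live stages instead of §7's sum)»).
File 38: `S` INDEPENDENT tests pay §7's SUM `V = S`.  For ADAPTIVE (history-dependent) tests §8 proves, pointwise and whatever the dependence of the tests on
the older path, `Σ_σ Σ_i hits ≤ ∏_σ (ν_σ + 1) − 1` (`sum_hits_livePaths_le`) and `Σ_σ Σ_i (hits + hitsAbove) ≤ 2(∏_σ (ν_σ + 1) − 1)` (`sum_hits₂_livePaths_le`).
Is the product an artefact of the counting, or is it attained?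

ANSWER ([folklore]; this file): ATTAINED, BOTH COUNTS AT ONCE, FOR EVERY `S : ℕ` AND EVERY `ν : ℕ → ℕ`, by ONE explicit decision tree on
`n = ∏_{σ<S} (ν_σ + 1)` candidate indices (path values and tests in `ℕ`, dead prefix `a₀ = 0`): the MIXED-RADIX TREE.  Write `L_σ = ∏_{σ ≤ τ < S}(ν_τ + 1)`
(so `L_0 = n`, `L_S = 1`, `L_σ = (ν_σ + 1)L_{σ+1}`); after `σ` live stages the path value at candidate `i` is the digit prefix `⌊i ∕ L_σ⌋`
(`livePaths_eq_div`); stage `σ`, at older value `a`, inserts the `ν_σ` tests `t = 1, …, ν_σ` with flip indices `a·L_σ + t·L_{σ+1}` — the `ν_σ` interior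
cut points of the stretch `[a·L_σ, (a+1)·L_σ)` of constant older path — and moves to `a·(ν_σ + 1) + (ν_σ − #small tests) = ⌊i ∕ L_{σ+1}⌋`.  Every test
flips strictly inside its stretch, so it scores ONE hit below (at `i = flip − 1`) and ONE hit above (at `i = flip`), and every flip is a jump of the new
path: stage `σ` scores exactly `ν_σ·∏_{τ<σ}(ν_τ + 1)` hits of each kind (`sum_hits_stage_eq`, `sum_hitsAbove_stage_eq`), and the telescoping sum
`Σ_σ ν_σ ∏_{τ<σ}(ν_τ + 1) = ∏_σ(ν_σ + 1) − 1` (`sum_prod_mul_add_one`) gives EQUALITY in both bounds of §8: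
* **`cascadeCount_attained`** — `∃ st, (∀ σ a, #tests = ν_σ) ∧ Σ_σ Σ_{i<n} hits + 1 = ∏_σ (ν_σ + 1) ∧ Σ_σ Σ_{i<n} (hits + hitsAbove) + 2 = 2∏_σ (ν_σ + 1)`;
* **`cascadeCount_isGreatest`** ∕ **`cascadeCount₂_isGreatest`** — over ALL decision trees (path values and tests in any types, any dead prefix, any
  number of candidates) with `#tests ≤ ν_σ` per stage and older path, the largest total hit count IS `∏_σ(ν_σ + 1) − 1`, the largest two-sided count
  IS `2(∏_σ(ν_σ + 1) − 1)` (upper bounds = the tree's `sum_hits_livePaths_le` ∕ `sum_hits₂_livePaths_le` BY NAME; attained = this file);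
* **`exists_variable_of_flipIndex`** — every prescribed flip index `φ` IS the flip index of a genuine monotone threshold test `u < θ·c^i` with the common
  live factor `c^i`, `0 < c < 1`, `0 < θ` (take `u = θ·c^φ`): the extremal tree is an instance of §8's reading (R) with threshold tests whose variables
  depend on the older path — nothing outside the abstraction is used;
* **`twoRun_pigeonhole_sharp`** — the OTHER numerical constant of the (δ-1) choice function `exists_liveFactor_choice_function`, the two-run factor of
  `exists_common_index_of_totals` (`(V_A + V_B)∕n`, i.e. `2V∕n`), cannot be lowered either: two runs concentrating on complementary halves of the
  candidates defeat every `c·2V∕n`, `c < 1`.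

WHAT THIS SHOWS ∕ DOES NOT SHOW (honest).  SHOWS: on the (R)+(W1) abstraction of `T4ShellMeasure` §8 (live stages, `≤ ν_σ` booked tests per stage GIVEN THE
OLDER PATH, arbitrary dependence on the older path) the cascade constant `V = 2(∏_σ(ν_σ + 1) − 1)` of the (δ-1) member CANNOT BE LOWERED: any smaller `V`
needs structure beyond (R)+(W1) (e.g. independence across stages, file 38: `V = S`); nor can the two-run factor `2` of the choice function.  So in the
END's constant `Wsh K ≤ 2e^{2a}·(V·M)·ϑ^K` of `shellWeightBound_of_liveFactor` both counting constants are final on the abstraction.  The located remark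
«price of adaptivity» of files 37∕38 is thereby EXACT: sum `Σ_σ ν_σ`-type constants for independent tests, the full product for adaptive ones, nothing
in between from counting alone.  DOES NOT SHOW:
that Bałaban's expansion realizes the extremal tree (node O), anything about (L1-step), or any measure-level statement beyond §8's pointwise wrapper.
BY-NAME EFFECT ON THE WALL: none (MODEL ∕ sharpness of a kernel count).  VERDICT WORD UNCHANGED: WORK-bound behind node O; INSTANCE 0∕1.  NE7c ∕ NE7b NOT
PRINTED ∕ NOT PROVED; spine 0∕9; one finite T⁴ — NOT ℝ⁴, NOT infinite volume, NOT the mass gap, NOT Clay.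
HONEST DEPENDENCY (cell): continuum YM on T⁴ ⇐ BetaPertH ∧ nine spine estimates (0∕9 proved); BetaPertH ⇐ (D1) ∧ (D4) ∧ CAP+tail.
-/

set_option autoImplicit false

open Finset
open Literature.MathematicalPhysics.QuantumFieldTheory.Balaban1983to89
open Literature.MathematicalPhysics.QuantumFieldTheory.Balaban1983to89.T4ShellMeasure

namespace Summit.QuantumFields.BalabanUV.T4Continuum.Spine.NE7c.LiveFactorCascadeSharp

/-! ## §1 Counting lemmas: block sums of a periodic summand, one cut point per test, the telescoping sum -/

/-- BLOCK SUMS: a summand depending on `i % M` only sums over `P` blocks to `P` times one block. [folklore] -/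
theorem sum_range_mul_mod (P M : ℕ) (g : ℕ → ℕ) :
    ∑ i ∈ range (P * M), g (i % M) = P * ∑ j ∈ range M, g j := by
  induction P with
  | zero => simp
  | succ P ih =>
    have h1 : (P + 1) * M = P * M + M := by ring
    rw [h1, sum_range_add, ih, add_one_mul]
    congr 1
    refine sum_congr rfl fun j hj => ?_
    rw [Nat.mul_add_mod', Nat.mod_eq_of_lt (mem_range.1 hj)]

/-- ONE HIT OF EACH KIND PER TEST: for `1 ≤ t ≤ ν`, `0 < M` and offset `e ≤ 1` (`e = 1`: below, `e = 0`: above) exactly one `j < (ν + 1)M`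
has `tM = j + e`. [folklore] -/
theorem sum_ite_mul_eq_add {ν M t e : ℕ} (hM : 0 < M) (ht1 : 1 ≤ t) (htν : t ≤ ν) (he : e ≤ 1) :
    ∑ j ∈ range ((ν + 1) * M), (if t * M = j + e then 1 else 0) = 1 := by
  have htM : 1 ≤ t * M := Nat.one_le_iff_ne_zero.2 (Nat.mul_ne_zero (by omega) (by omega))
  have key : ∀ j : ℕ, (t * M = j + e ↔ j = t * M - e) := fun j => by omega
  simp_rw [key]
  rw [sum_ite_eq', if_pos]
  have h2 : t * M ≤ ν * M := Nat.mul_le_mul_right _ htν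
  have h3 : ν * M < (ν + 1) * M := by nlinarith
  exact mem_range.2 (by omega)

/-- summing one kind of hits of one stretch over its `(ν + 1)M` candidates: every one of the `ν` tests scores exactly once. [folklore] -/
theorem sum_card_filter_mul_eq_add (ν M : ℕ) {e : ℕ} (hM : 0 < M) (he : e ≤ 1) :
    ∑ j ∈ range ((ν + 1) * M), ((Icc 1 ν).filter fun t => t * M = j + e).card = ν := by
  simp_rw [card_filter]
  rw [sum_comm]
  calc ∑ t ∈ Icc 1 ν, ∑ j ∈ range ((ν + 1) * M), (if t * M = j + e then 1 else 0)
      = ∑ t ∈ Icc 1 ν, 1 := sum_congr rfl fun t ht => by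
          rw [mem_Icc] at ht
          exact sum_ite_mul_eq_add hM ht.1 ht.2 he
    _ = ν := by simp

/-- THE TELESCOPING SUM: `Σ_{σ<S} ν_σ·∏_{τ<σ}(ν_τ + 1) + 1 = ∏_{σ<S}(ν_σ + 1)`. [folklore] -/
theorem sum_prod_mul_add_one (S : ℕ) (ν : ℕ → ℕ) :
    (∑ σ ∈ range S, (∏ τ ∈ range σ, (ν τ + 1)) * ν σ) + 1 = ∏ σ ∈ range S, (ν σ + 1) := by
  induction S with
  | zero => simp
  | succ S ih =>
    rw [sum_range_succ, prod_range_succ, ← ih]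
    ring

/-! ## §2 One live stage of the mixed-radix tree: `ν` tests cutting a stretch of length `(ν + 1)M` into `ν + 1` stretches of length `M` -/

section OneStage

variable {ν M : ℕ} (st : LiveStage ℕ ℕ)

/-- THE PATH AFTER THE STAGE: from older value `⌊i ∕ ((ν+1)M)⌋` the stage moves to `⌊i ∕ M⌋` (the next digit is appended). [folklore] -/
theorem path_eq_div (hM : 0 < M) (htests : ∀ a, st.tests a = Icc 1 ν)
    (hflip : ∀ a t, st.flip a t = a * ((ν + 1) * M) + t * M)
    (hnext : ∀ a T, st.next a T = a * (ν + 1) + (ν - T.card))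
    (q : ℕ → ℕ) (i : ℕ) (hq : q i = i / ((ν + 1) * M)) : st.path q i = i / M := by
  have hL : 0 < (ν + 1) * M := Nat.mul_pos (Nat.succ_pos ν) hM
  set a := i / ((ν + 1) * M) with ha
  set j := i % ((ν + 1) * M) with hj
  have hi : a * ((ν + 1) * M) + j = i := by rw [ha, hj, mul_comm]; exact Nat.div_add_mod i ((ν + 1) * M)
  have hjlt : j < (ν + 1) * M := Nat.mod_lt i hL
  set d := j / M with hd
  have hdν : d ≤ ν := Nat.lt_succ_iff.1 ((Nat.div_lt_iff_lt_mul hM).2 hjlt)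
  -- the small tests at candidate `i` are `t = d + 1, …, ν`
  have hfilter : ((st.tests (q i)).filter fun t => i < st.flip (q i) t) = Icc (d + 1) ν := by
    ext t
    have h2 : (j < t * M ↔ d < t) := (Nat.div_lt_iff_lt_mul hM).symm
    simp only [mem_filter, htests, mem_Icc, hflip, hq]
    constructor
    · rintro ⟨⟨-, htν⟩, hlt⟩
      have hjt : j < t * M := by omega
      exact ⟨Nat.succ_le_of_lt (h2.1 hjt), htν⟩
    · rintro ⟨hdt, htν⟩
      have hjt : j < t * M := h2.2 (Nat.lt_of_succ_le hdt)
      exact ⟨⟨le_trans (Nat.succ_le_succ (Nat.zero_le d)) hdt, htν⟩, by omega⟩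
  have hcard : ((st.tests (q i)).filter fun t => i < st.flip (q i) t).card = ν - d := by rw [hfilter, Nat.card_Icc]; omega
  rw [LiveStage.path, hnext, hcard, hq, Nat.sub_sub_self hdν]
  have hi' : i = j + a * (ν + 1) * M := by rw [mul_assoc]; omega
  rw [hi', Nat.add_mul_div_right _ _ hM, ← hd]
  ring

/-- THE HITS BELOW AT CANDIDATE `i`: the tests `t` with `tM = (i mod (ν+1)M) + 1`. [folklore] -/
theorem hits_eq_card (hM : 0 < M) (htests : ∀ a, st.tests a = Icc 1 ν)
    (hflip : ∀ a t, st.flip a t = a * ((ν + 1) * M) + t * M)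
    (q : ℕ → ℕ) (i : ℕ) (hq : q i = i / ((ν + 1) * M)) :
    st.hits q i = ((Icc 1 ν).filter fun t => t * M = i % ((ν + 1) * M) + 1).card := by
  have hL : 0 < (ν + 1) * M := Nat.mul_pos (Nat.succ_pos ν) hM
  have hi : i / ((ν + 1) * M) * ((ν + 1) * M) + i % ((ν + 1) * M) = i := Nat.div_add_mod' i ((ν + 1) * M)
  rw [LiveStage.hits, htests]
  congr 1
  refine filter_congr fun t _ => ?_
  rw [hflip, hq]
  omega

/-- THE HITS ABOVE AT CANDIDATE `i`: the tests `t` with `tM = i mod (ν+1)M` (written with the offset `+ 0`). [folklore] -/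
theorem hitsAbove_eq_card (hM : 0 < M) (htests : ∀ a, st.tests a = Icc 1 ν)
    (hflip : ∀ a t, st.flip a t = a * ((ν + 1) * M) + t * M)
    (q : ℕ → ℕ) (i : ℕ) (hq : q i = i / ((ν + 1) * M)) :
    st.hitsAbove q i = ((Icc 1 ν).filter fun t => t * M = i % ((ν + 1) * M) + 0).card := by
  have hL : 0 < (ν + 1) * M := Nat.mul_pos (Nat.succ_pos ν) hM
  have hi : i / ((ν + 1) * M) * ((ν + 1) * M) + i % ((ν + 1) * M) = i := Nat.div_add_mod' i ((ν + 1) * M)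
  rw [LiveStage.hitsAbove, htests]
  congr 1
  refine filter_congr fun t _ => ?_
  rw [hflip, hq]
  omega

end OneStage

/-! ## §3 The mixed-radix tree through `S` live stages: paths are digit prefixes, stage `σ` scores `ν_σ·∏_{τ<σ}(ν_τ+1)` hits of each kind -/

section Tree

variable {S : ℕ} {ν L : ℕ → ℕ} (st : ℕ → LiveStage ℕ ℕ)

/-- the scales: `L_0 = (∏_{τ<σ}(ν_τ + 1))·L_σ` for `σ ≤ S`. [folklore] -/
theorem scale_zero_eq (hL : ∀ σ < S, L σ = (ν σ + 1) * L (σ + 1)) :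
    ∀ σ ≤ S, L 0 = (∏ τ ∈ range σ, (ν τ + 1)) * L σ := by
  intro σ hσ
  induction σ with
  | zero => simp
  | succ σ ih =>
    rw [ih (Nat.le_of_succ_le hσ), prod_range_succ, hL σ (Nat.lt_of_succ_le hσ)]
    ring

/-- **PATHS ARE DIGIT PREFIXES**: after `σ ≤ S` live stages the path value at candidate `i < L_0` is `⌊i ∕ L_σ⌋`. [folklore] -/
theorem livePaths_eq_div (hL : ∀ σ < S, L σ = (ν σ + 1) * L (σ + 1)) (hLpos : ∀ σ, 0 < L σ)
    (htests : ∀ σ a, (st σ).tests a = Icc 1 (ν σ))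
    (hflip : ∀ σ a t, (st σ).flip a t = a * L σ + t * L (σ + 1))
    (hnext : ∀ σ a T, (st σ).next a T = a * (ν σ + 1) + (ν σ - T.card)) :
    ∀ σ ≤ S, ∀ i < L 0, livePaths st 0 σ i = i / L σ := by
  intro σ hσ
  induction σ with
  | zero => intro i hi; simp [livePaths, Nat.div_eq_of_lt hi]
  | succ σ ih =>
    intro i hi
    have hσS : σ < S := Nat.lt_of_succ_le hσ
    have hq : livePaths st 0 σ i = i / ((ν σ + 1) * L (σ + 1)) := by rw [ih (Nat.le_of_succ_le hσ) i hi, hL σ hσS]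
    simp only [livePaths]
    exact path_eq_div (st σ) (hLpos (σ + 1)) (htests σ) (fun a t => by rw [hflip, hL σ hσS]) (hnext σ) _ i hq

/-- the core of both stage counts: a per-candidate count of the form `#{t ≤ ν_σ : t·L_{σ+1} = (i mod L_σ) + e}`, `e ≤ 1`, sums over the `L_0`
candidates to `ν_σ·∏_{τ<σ}(ν_τ + 1)` (block sums, one score per test and stretch). [folklore] -/
theorem sum_stage_core (hL : ∀ σ < S, L σ = (ν σ + 1) * L (σ + 1)) (hLpos : ∀ σ, 0 < L σ) {σ e : ℕ} (hσ : σ < S)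
    (he : e ≤ 1) (g : ℕ → ℕ) (hg : ∀ i < L 0, g i = ((Icc 1 (ν σ)).filter fun t => t * L (σ + 1) = i % L σ + e).card) :
    ∑ i ∈ range (L 0), g i = (∏ τ ∈ range σ, (ν τ + 1)) * ν σ := by
  calc ∑ i ∈ range (L 0), g i
      = ∑ i ∈ range (L 0), ((Icc 1 (ν σ)).filter fun t => t * L (σ + 1) = i % L σ + e).card :=
        sum_congr rfl fun i hi => hg i (mem_range.1 hi)
    _ = (∏ τ ∈ range σ, (ν τ + 1)) * ∑ j ∈ range (L σ), ((Icc 1 (ν σ)).filter fun t => t * L (σ + 1) = j + e).card := by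
        rw [scale_zero_eq hL σ hσ.le]
        exact sum_range_mul_mod _ _ (fun j => ((Icc 1 (ν σ)).filter fun t => t * L (σ + 1) = j + e).card)
    _ = (∏ τ ∈ range σ, (ν τ + 1)) * ν σ := by rw [hL σ hσ, sum_card_filter_mul_eq_add _ _ (hLpos (σ + 1)) he]

/-- **STAGE `σ` SCORES EXACTLY `ν_σ·∏_{τ<σ}(ν_τ + 1)` HITS BELOW** along the `L_0` candidates. [folklore] -/
theorem sum_hits_stage_eq (hL : ∀ σ < S, L σ = (ν σ + 1) * L (σ + 1)) (hLpos : ∀ σ, 0 < L σ)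
    (htests : ∀ σ a, (st σ).tests a = Icc 1 (ν σ))
    (hflip : ∀ σ a t, (st σ).flip a t = a * L σ + t * L (σ + 1))
    (hnext : ∀ σ a T, (st σ).next a T = a * (ν σ + 1) + (ν σ - T.card)) {σ : ℕ} (hσ : σ < S) :
    ∑ i ∈ range (L 0), (st σ).hits (livePaths st 0 σ) i = (∏ τ ∈ range σ, (ν τ + 1)) * ν σ := by
  refine sum_stage_core hL hLpos hσ le_rfl _ fun i hi => ?_
  have hq : livePaths st 0 σ i = i / ((ν σ + 1) * L (σ + 1)) := by
    rw [livePaths_eq_div st hL hLpos htests hflip hnext σ hσ.le i hi, hL σ hσ]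
  rw [hL σ hσ]
  exact hits_eq_card (st σ) (hLpos (σ + 1)) (htests σ) (fun a t => by rw [hflip, hL σ hσ]) _ i hq

/-- **STAGE `σ` SCORES EXACTLY `ν_σ·∏_{τ<σ}(ν_τ + 1)` HITS ABOVE** along the `L_0` candidates. [folklore] -/
theorem sum_hitsAbove_stage_eq (hL : ∀ σ < S, L σ = (ν σ + 1) * L (σ + 1)) (hLpos : ∀ σ, 0 < L σ)
    (htests : ∀ σ a, (st σ).tests a = Icc 1 (ν σ))
    (hflip : ∀ σ a t, (st σ).flip a t = a * L σ + t * L (σ + 1))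
    (hnext : ∀ σ a T, (st σ).next a T = a * (ν σ + 1) + (ν σ - T.card)) {σ : ℕ} (hσ : σ < S) :
    ∑ i ∈ range (L 0), (st σ).hitsAbove (livePaths st 0 σ) i = (∏ τ ∈ range σ, (ν τ + 1)) * ν σ := by
  refine sum_stage_core hL hLpos hσ (Nat.zero_le 1) _ fun i hi => ?_
  have hq : livePaths st 0 σ i = i / ((ν σ + 1) * L (σ + 1)) := by
    rw [livePaths_eq_div st hL hLpos htests hflip hnext σ hσ.le i hi, hL σ hσ]
  rw [hL σ hσ]
  exact hitsAbove_eq_card (st σ) (hLpos (σ + 1)) (htests σ) (fun a t => by rw [hflip, hL σ hσ]) _ i hq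

/-- **THE ONE-SIDED COUNT WITH EQUALITY**: `Σ_{σ<S} Σ_{i<L_0} hits + 1 = ∏_{σ<S}(ν_σ + 1)`. [folklore] -/
theorem sum_hits_tree_eq (hL : ∀ σ < S, L σ = (ν σ + 1) * L (σ + 1)) (hLpos : ∀ σ, 0 < L σ)
    (htests : ∀ σ a, (st σ).tests a = Icc 1 (ν σ))
    (hflip : ∀ σ a t, (st σ).flip a t = a * L σ + t * L (σ + 1))
    (hnext : ∀ σ a T, (st σ).next a T = a * (ν σ + 1) + (ν σ - T.card)) :
    (∑ σ ∈ range S, ∑ i ∈ range (L 0), (st σ).hits (livePaths st 0 σ) i) + 1 = ∏ σ ∈ range S, (ν σ + 1) := by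
  rw [← sum_prod_mul_add_one S ν]
  congr 1
  exact sum_congr rfl fun σ hσ => sum_hits_stage_eq st hL hLpos htests hflip hnext (mem_range.1 hσ)

/-- **THE TWO-SIDED COUNT WITH EQUALITY**: `Σ_{σ<S} Σ_{i<L_0} (hits + hitsAbove) + 2 = 2·∏_{σ<S}(ν_σ + 1)`. [folklore] -/
theorem sum_hits₂_tree_eq (hL : ∀ σ < S, L σ = (ν σ + 1) * L (σ + 1)) (hLpos : ∀ σ, 0 < L σ)
    (htests : ∀ σ a, (st σ).tests a = Icc 1 (ν σ))
    (hflip : ∀ σ a t, (st σ).flip a t = a * L σ + t * L (σ + 1))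
    (hnext : ∀ σ a T, (st σ).next a T = a * (ν σ + 1) + (ν σ - T.card)) :
    (∑ σ ∈ range S, ∑ i ∈ range (L 0),
        ((st σ).hits (livePaths st 0 σ) i + (st σ).hitsAbove (livePaths st 0 σ) i)) + 2
      = 2 * ∏ σ ∈ range S, (ν σ + 1) := by
  rw [← sum_prod_mul_add_one S ν]
  have h : ∀ σ ∈ range S, ∑ i ∈ range (L 0), ((st σ).hits (livePaths st 0 σ) i + (st σ).hitsAbove (livePaths st 0 σ) i)
      = 2 * ((∏ τ ∈ range σ, (ν τ + 1)) * ν σ) := fun σ hσ => by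
    rw [sum_add_distrib, sum_hits_stage_eq st hL hLpos htests hflip hnext (mem_range.1 hσ),
      sum_hitsAbove_stage_eq st hL hLpos htests hflip hnext (mem_range.1 hσ), two_mul]
  rw [sum_congr rfl h, ← mul_sum]
  ring

end Tree

/-! ## §4 The headline: the cascade count of `T4ShellMeasure` §8 is attained, for every `S` and every `ν` -/

/-- **THE CASCADE COUNT IS ATTAINED** (both kinds at once): for every number `S` of live stages and every profile `ν` of booked tests per stage
there is a decision tree with path values and tests in `ℕ` — the mixed-radix tree on `n = ∏_{σ<S}(ν_σ + 1)` candidates, dead prefix `0`, EXACTLY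
`ν_σ` tests at stage `σ` for every older path — with `Σ_σ Σ_{i<n} hits + 1 = ∏_σ(ν_σ + 1)` and `Σ_σ Σ_{i<n} (hits + hitsAbove) + 2 = 2∏_σ(ν_σ + 1)`.
[folklore] -/
theorem cascadeCount_attained (S : ℕ) (ν : ℕ → ℕ) :
    ∃ st : ℕ → LiveStage ℕ ℕ, (∀ σ a, ((st σ).tests a).card = ν σ) ∧
      (∑ σ ∈ range S, ∑ i ∈ range (∏ τ ∈ range S, (ν τ + 1)), (st σ).hits (livePaths st 0 σ) i) + 1
        = ∏ σ ∈ range S, (ν σ + 1) ∧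
      (∑ σ ∈ range S, ∑ i ∈ range (∏ τ ∈ range S, (ν τ + 1)),
          ((st σ).hits (livePaths st 0 σ) i + (st σ).hitsAbove (livePaths st 0 σ) i)) + 2
        = 2 * ∏ σ ∈ range S, (ν σ + 1) := by
  -- the scales `L σ = ∏_{σ ≤ τ < S} (ν τ + 1)`
  have hL : ∀ σ < S, (∏ τ ∈ Ico σ S, (ν τ + 1)) = (ν σ + 1) * ∏ τ ∈ Ico (σ + 1) S, (ν τ + 1) :=
    fun σ hσ => prod_eq_prod_Ico_succ_bot hσ _
  have hLpos : ∀ σ, 0 < ∏ τ ∈ Ico σ S, (ν τ + 1) := fun σ => prod_pos fun τ _ => Nat.succ_pos _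
  have hL0 : (∏ τ ∈ Ico 0 S, (ν τ + 1)) = ∏ τ ∈ range S, (ν τ + 1) := by rw [range_eq_Ico]
  -- the mixed-radix tree
  obtain ⟨st, hst⟩ : ∃ st : ℕ → LiveStage ℕ ℕ, ∀ σ, st σ = ⟨fun _ => Icc 1 (ν σ),
      fun a t => a * (∏ τ ∈ Ico σ S, (ν τ + 1)) + t * ∏ τ ∈ Ico (σ + 1) S, (ν τ + 1),
      fun a T => a * (ν σ + 1) + (ν σ - T.card)⟩ := ⟨_, fun _ => rfl⟩
  have htests : ∀ σ a, (st σ).tests a = Icc 1 (ν σ) := fun σ a => by rw [hst]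
  have hflip : ∀ σ a t, (st σ).flip a t = a * (∏ τ ∈ Ico σ S, (ν τ + 1)) + t * ∏ τ ∈ Ico (σ + 1) S, (ν τ + 1) :=
    fun σ a t => by rw [hst]
  have hnext : ∀ σ a T, (st σ).next a T = a * (ν σ + 1) + (ν σ - T.card) := fun σ a T => by rw [hst]
  refine ⟨st, fun σ a => ?_, ?_, ?_⟩
  · rw [htests, Nat.card_Icc]; omega
  · have h := sum_hits_tree_eq (L := fun σ => ∏ τ ∈ Ico σ S, (ν τ + 1)) st hL hLpos htests hflip hnext
    rw [hL0] at h
    exact h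
  · have h := sum_hits₂_tree_eq (L := fun σ => ∏ τ ∈ Ico σ S, (ν τ + 1)) st hL hLpos htests hflip hnext
    rw [hL0] at h
    exact h

/-- **`sum_hits_livePaths_le` IS SHARP**: over ALL decision trees (path values and tests in any types, any dead prefix, any number of candidates,
at most `ν_σ` booked tests at stage `σ` for every older path) the GREATEST total number of shell hits below is exactly `∏_{σ<S}(ν_σ + 1) − 1` (upper
bound: the tree's cascade count BY NAME; attained: the mixed-radix tree, already with path values and tests in `ℕ`). [folklore] -/
theorem cascadeCount_isGreatest (S : ℕ) (ν : ℕ → ℕ) :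
    IsGreatest {m : ℕ | ∃ (α τ : Type) (st : ℕ → LiveStage α τ) (a₀ : α) (n : ℕ), (∀ σ a, ((st σ).tests a).card ≤ ν σ) ∧
      m = ∑ σ ∈ range S, ∑ i ∈ range n, (st σ).hits (livePaths st a₀ σ) i} (∏ σ ∈ range S, (ν σ + 1) - 1) := by
  classical
  constructor
  · obtain ⟨st, hcard, h1, -⟩ := cascadeCount_attained S ν
    exact ⟨ℕ, ℕ, st, 0, ∏ τ ∈ range S, (ν τ + 1), fun σ a => (hcard σ a).le, by omega⟩
  · rintro m ⟨α, τ, st, a₀, n, hν, rfl⟩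
    have h := sum_hits_livePaths_le st a₀ n ν hν S
    omega

/-- **`sum_hits₂_livePaths_le` IS SHARP**: the GREATEST two-sided total (hits below plus hits above) is exactly `2(∏_{σ<S}(ν_σ + 1) − 1)` — the
cascade constant `V` of the (δ-1) member `shellWeightBound_of_liveFactor` cannot be lowered on the (R)+(W1) abstraction. [folklore] -/
theorem cascadeCount₂_isGreatest (S : ℕ) (ν : ℕ → ℕ) :
    IsGreatest {m : ℕ | ∃ (α τ : Type) (st : ℕ → LiveStage α τ) (a₀ : α) (n : ℕ), (∀ σ a, ((st σ).tests a).card ≤ ν σ) ∧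
      m = ∑ σ ∈ range S, ∑ i ∈ range n, ((st σ).hits (livePaths st a₀ σ) i + (st σ).hitsAbove (livePaths st a₀ σ) i)}
      (2 * (∏ σ ∈ range S, (ν σ + 1) - 1)) := by
  classical
  constructor
  · obtain ⟨st, hcard, -, h2⟩ := cascadeCount_attained S ν
    refine ⟨ℕ, ℕ, st, 0, ∏ τ ∈ range S, (ν τ + 1), fun σ a => (hcard σ a).le, ?_⟩
    have hpos : 1 ≤ ∏ σ ∈ range S, (ν σ + 1) := prod_pos fun σ _ => Nat.succ_pos _
    omega
  · rintro m ⟨α, τ, st, a₀, n, hν, rfl⟩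
    have h := sum_hits₂_livePaths_le st a₀ n ν hν S
    have hpos : 1 ≤ ∏ σ ∈ range S, (ν σ + 1) := prod_pos fun σ _ => Nat.succ_pos _
    omega

/-- the gap between §7's SUM and §8's PRODUCT is attained too: with ONE test per stage (`ν ≡ 1`, `S` stages) the mixed-radix (binary) tree scores
`2^S − 1` hits below and `2(2^S − 1)` two-sided — against `V = S` for `S` INDEPENDENT single tests (file 38). [folklore] -/
theorem cascadeCount_attained_binary (S : ℕ) :
    ∃ st : ℕ → LiveStage ℕ ℕ, (∀ σ a, ((st σ).tests a).card = 1) ∧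
      (∑ σ ∈ range S, ∑ i ∈ range (2 ^ S), (st σ).hits (livePaths st 0 σ) i) + 1 = 2 ^ S ∧
      (∑ σ ∈ range S, ∑ i ∈ range (2 ^ S),
          ((st σ).hits (livePaths st 0 σ) i + (st σ).hitsAbove (livePaths st 0 σ) i)) + 2 = 2 * 2 ^ S := by
  simpa using cascadeCount_attained S (fun _ => 1)

/-! ## §5 The extremal tree is a genuine threshold-test tree: every flip index is realized by a variable against the common live factor -/

/-- **EVERY FLIP INDEX IS REALIZED BY A THRESHOLD TEST WITH THE COMMON LIVE FACTOR**: for `0 < θ`, `0 < c < 1` and any `φ`, the variable value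
`u = θ·c^φ` reads small (`u < θ·c^i`) exactly at the candidate indices `i < φ` — so the prescribed flip indices of the mixed-radix tree are those of
genuine monotone tests `u(x; older path) < θ·λ_i` of `T4ShellMeasure` §8 (cf. `exists_flipIndex_threshold`, the converse direction). [folklore] -/
theorem exists_variable_of_flipIndex {θ c : ℝ} (hθ : 0 < θ) (hc0 : 0 < c) (hc1 : c < 1) (φ : ℕ) :
    ∃ u : ℝ, 0 < u ∧ ∀ i : ℕ, (u < θ * c ^ i ↔ i < φ) := by
  refine ⟨θ * c ^ φ, mul_pos hθ (pow_pos hc0 φ), fun i => ?_⟩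
  rw [mul_lt_mul_iff_right₀ hθ]
  exact pow_lt_pow_iff_right_of_lt_one₀ hc0 hc1

/-- hence the tests of ANY decision tree on the (R)+(W1) abstraction — in particular of the extremal one — are realized, older value by older value,
by variables `u a t = θ·c^{flip a t} > 0` against the common live factor: `u a t < θ·c^i ↔ i < flip a t`. [folklore] -/
theorem exists_variables_of_liveStage {α τ : Type*} {θ c : ℝ} (hθ : 0 < θ) (hc0 : 0 < c) (hc1 : c < 1) (st : LiveStage α τ) :
    ∃ u : α → τ → ℝ, ∀ a t, 0 < u a t ∧ ∀ i : ℕ, (u a t < θ * c ^ i ↔ i < st.flip a t) :=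
  ⟨fun a t => θ * c ^ st.flip a t, fun a t => ⟨mul_pos hθ (pow_pos hc0 _), fun i => by
    rw [mul_lt_mul_iff_right₀ hθ]; exact pow_lt_pow_iff_right_of_lt_one₀ hc0 hc1⟩⟩

/-! ## §6 The other constant of the (δ-1) choice function is sharp too: the two-run pigeonhole `exists_common_index_of_totals` -/

/-- **THE TWO-RUN PIGEONHOLE IS SHARP**: `T4ShellMeasure.exists_common_index_of_totals` gives, from candidate-summed totals `Σ_i F_A ≤ V_A·Z_A`
and `Σ_i F_B ≤ V_B·Z_B` on `n` candidates, ONE index with `F_A i ≤ ((V_A + V_B)∕n)·Z_A` AND `F_B i ≤ ((V_A + V_B)∕n)·Z_B` — twice the one-run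
average when `V_A = V_B`.  The factor cannot be lowered: for every `k ≥ 1`, `V > 0` and every `c < 1`, on `n = 2k` candidates with `Z_A = Z_B = 1`,
run A's totals `V∕k` on the first `k` candidates (else `0`) and run B's `V∕k` on the last `k` (else `0`) have sums `≤ V`, yet NO candidate has both
totals `≤ c·((V + V)∕n)`. [folklore] -/
theorem twoRun_pigeonhole_sharp {k : ℕ} (hk : 0 < k) {V c : ℝ} (hV : 0 < V) (hc : c < 1) :
    ∃ FA FB : ℕ → ℝ, (∀ i, 0 ≤ FA i) ∧ (∀ i, 0 ≤ FB i) ∧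
      ∑ i ∈ range (2 * k), FA i ≤ V * 1 ∧ ∑ i ∈ range (2 * k), FB i ≤ V * 1 ∧
      ∀ i ∈ range (2 * k), ¬ (FA i ≤ c * ((V + V) / (2 * k : ℕ)) * 1 ∧ FB i ≤ c * ((V + V) / (2 * k : ℕ)) * 1) := by
  have hk' : (0 : ℝ) < k := Nat.cast_pos.2 hk
  have hVk : 0 < V / k := div_pos hV hk'
  have hthr : c * ((V + V) / (2 * k : ℕ)) * 1 < V / k := by
    have h1 : (V + V) / ((2 * k : ℕ) : ℝ) = V / k := by rw [Nat.cast_mul, Nat.cast_two]; field_simp; ring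
    rw [h1, mul_one]; nlinarith [mul_lt_mul_of_pos_right hc hVk]
  refine ⟨fun i => if i < k then V / k else 0, fun i => if i < k then 0 else V / k,
    fun i => ?_, fun i => ?_, ?_, ?_, fun i _ => ?_⟩
  · by_cases h : i < k <;> simp [h, hVk.le]
  · by_cases h : i < k <;> simp [h, hVk.le]
  · rw [two_mul, sum_range_add]
    have h1 : ∑ x ∈ range k, (if x < k then V / k else 0) = ∑ _x ∈ range k, V / k :=
      sum_congr rfl fun x hx => if_pos (mem_range.1 hx)
    have h2 : ∑ x ∈ range k, (if k + x < k then V / k else 0) = 0 :=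
      sum_eq_zero fun x _ => if_neg (by omega)
    rw [h1, h2, sum_const, card_range, nsmul_eq_mul, add_zero, mul_one, mul_div_cancel₀ _ hk'.ne']
  · rw [two_mul, sum_range_add]
    have h1 : ∑ x ∈ range k, (if x < k then (0 : ℝ) else V / k) = 0 :=
      sum_eq_zero fun x hx => if_pos (mem_range.1 hx)
    have h2 : ∑ x ∈ range k, (if k + x < k then (0 : ℝ) else V / k) = ∑ _x ∈ range k, V / k :=
      sum_congr rfl fun x _ => if_neg (by omega)
    rw [h1, h2, sum_const, card_range, nsmul_eq_mul, zero_add, mul_one, mul_div_cancel₀ _ hk'.ne']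
  · rintro ⟨hA, hB⟩
    by_cases h : i < k
    · simp only [h, if_true] at hA; exact absurd (hA.trans_lt hthr) (lt_irrefl _)
    · simp only [h, if_false] at hB; exact absurd (hB.trans_lt hthr) (lt_irrefl _)

end Summit.QuantumFields.BalabanUV.T4Continuum.Spine.NE7c.LiveFactorCascadeSharp
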